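import Literature.MathematicalPhysics.QuantumLattice.DWaveSourceKomaTasakiField
import HarnessLib

/-!
# Koma–Tasaki for LOW-LYING long-range-ordered states of the Hubbard torus (sector ground states
# canonically supported up to `o(L²)`): `m* ≥ s/√2` persists

T. Koma, H. Tasaki, J. Stat. Phys. **76** (1994) 745–803 (`KomaTasaki1994`), Definition 2.1 ("low-lying
states": excitation energy per site `→ 0`), §1, §3.3; Commun. Math. Phys. **158** (1993) Theorem 7.3
(`KomaTasaki1993`).  The companion file `DWaveSourceKomaTasakiField.lean` proves KT93 Thm 7.3 for the
`d`-wave pair field when the long-range-ordered symmetric state `Φ` is a GROUND state of `H(1,U) - μN`.  The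
variational argument (7.4)–(7.5) only uses `E_Φ - E₀`: for an EIGENVECTOR `Φ` of `H(1,U) - μN` with energy
`E ≤ E₀ + δ` the sourced bound loses exactly `δ/(B·L²)`.  This is the form the summit needs: a SECTOR ground
state of `H(1,U)` at particle number `N_L` (an eigenvector of `H(1,U) - μN`) whose sector is canonically
supported by `μ` up to `δ_L = o(L²)` — the hypothesis shape of `HasPairFieldLRO` / of the
route-`AbsenceCertificate` engine `SourcedOrderDominatesLRO` (Kaplan–Horsch–von der Linden constant); here
with Koma–Tasaki's `√2`.

* `two_mul_dWaveSourceDensity_ge_of_pairLRO_lowLying` — ∀ `s ∈ (0,2K_d]`, `B > 0`, `ε > 0` ∃ `L₀` ∀ `L ≥ L₀`: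
  `Φ` normalised, `(H(1,U)-μN)Φ = EΦ`, `E ≤ E₀ + δ`, `NΦ = νΦ`, `(sL²)² ≤ Re Φ†(Δ_d+Δ_d†)²Φ` ⟹
  `2·dWaveSourceDensity L U μ B ≥ √2 s - ε - δ/(B L²)`;
* `le_dWaveOrderParameter_of_pairLRO_lowLying` — along `L+1`-tori eventually, with `δ_L/(L+1)² → 0`:
  `dWaveOrderParameter U μ ≥ √2 s/2`.

Direction LRO ⟹ response only (`Literature.Barriers.HubbardSuperconductivity.SourcedOrderWithoutGroundStateLRO`).
Conventions as in the companion files (`attribute [local instance] instDecidableEqFermionTorusKT`).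
-/

noncomputable section

open Matrix Complex Finset WithLp Literature.Probability.LatticeModels
open Literature.Barriers.HubbardSuperconductivity
open scoped Matrix.Norms.L2Operator InnerProductSpace ComplexConjugate ComplexOrder

namespace Literature.MathematicalPhysics.QuantumLattice

open KomaTasaki DWaveKT Filter
open scoped Topology

attribute [local instance 10000] instDecidableEqFermionTorusKT

section LowLying

variable {L : ℕ} [NeZero L]

/-- `|Λ| = L²`. [folklore] -/
private theorem card_torusSite_sq' : Fintype.card (TorusSite 2 L) = L ^ 2 := by
  simp [TorusSite, ZMod.card]

variable (U μ : ℝ)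

/-- **Tracial form with a LOW-LYING symmetric state** (KT94 Definition 2.1 "low-lying states"; KT93
Thm 7.3 with an excited `U(1)`-eigenstate of energy `E ≤ E₀ + δ` in place of the ground state): ∀
`s ∈ (0, 2K_d]`, `B > 0`, `ε > 0` ∃ `L₀` ∀ `L ≥ L₀`: a normalised particle-number eigenvector `Φ` which is an
EIGENVECTOR of `H(1,U) - μN` with eigenvalue `E ≤ E₀ + δ` and carries `(sL²)² ≤ Re Φ†(Δ_d+Δ_d†)²Φ` forces
`2·dWaveSourceDensity L U μ B ≥ √2 s - ε - δ/(B L²)`.  (With `δ = 0` this is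
`two_mul_dWaveSourceDensity_ge_of_pairLRO`; the case of use: a SECTOR ground state of `H(1,U)` at fixed
particle number whose sector is canonically supported by `μ` up to `δ = o(L²)` — the summit's setting,
`HasPairFieldLRO`, and the hypothesis of the route-`AbsenceCertificate` engine `SourcedOrderDominatesLRO`.)
[cite: KomaTasaki1993, Theorem 7.3, proof (7.4)–(7.5)] [cite: KomaTasaki1994, Definition 2.1, §1, §3.3] -/
theorem two_mul_dWaveSourceDensity_ge_of_pairLRO_lowLying (s B ε : ℝ) (hs : 0 < s)
    (hsK : s ≤ 2 * pairNormConst dWaveFormFactor) (hB : 0 < B) (hε : 0 < ε) :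
    ∃ L₀ : ℕ, ∀ (L : ℕ) [NeZero L], L₀ ≤ L →
      ∀ (Φ : FockIdx L → ℂ) (ν : ℂ) (E δ : ℝ), star Φ ⬝ᵥ Φ = 1 →
        hubbardTorusWith 2 L 1 U μ *ᵥ Φ = (E : ℂ) • Φ →
        E ≤ (hubbardTorusWith 2 L 1 U μ).groundEnergy + δ → totalNumber *ᵥ Φ = ν • Φ →
        (s * (L : ℝ) ^ 2) ^ 2 ≤
          (star Φ ⬝ᵥ ((pairField dWaveFormFactor L + (pairField dWaveFormFactor L)ᴴ) *ᵥ
            ((pairField dWaveFormFactor L + (pairField dWaveFormFactor L)ᴴ) *ᵥ Φ))).re →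
        Real.sqrt 2 * s - ε - δ / (B * (L : ℝ) ^ 2) ≤ 2 * dWaveSourceDensity L U μ B := by
  set K : ℝ := pairNormConst dWaveFormFactor with hKdef
  have hK : 0 < K := pairNormConst_dWave_pos
  set μ' : ℝ := s / (2 * K) with hμ'def
  have hμ' : 0 < μ' := by positivity
  have hμ'1 : μ' ≤ 1 := by rw [hμ'def, div_le_one (by positivity)]; exact hsK
  have hsμ : μ' * (2 * K) = s := by rw [hμ'def]; field_simp
  -- `k` from the trial-state half with `ε/2`
  obtain ⟨k₀, hk₀⟩ := theorem_2_5_orderOne_overlap_holds.{0, 0} μ' (2 * K) (ε / 2) 25 (half_pos hε)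
  obtain ⟨N₁, hN₁⟩ := hk₀ (max k₀ 1) (le_max_left _ _)
  set k : ℕ := max k₀ 1 with hk_def
  have hk1 : 1 ≤ k := le_max_right _ _
  -- the constant `D_k` of the class and the thresholds
  set h₀ : ℝ := 45 * (2 * |(1 : ℝ)| + |U| + 2 * |μ|) with hh₀def
  have hh₀ : 0 ≤ h₀ := by positivity
  set D : ℝ := (k : ℝ) * 2 ^ (k + 1) * h₀ * 25 / μ' ^ k with hD_def
  have hD0 : 0 ≤ D := by positivity
  set N₂ : ℕ := ⌈(k : ℝ) ^ 2 * 25 * 2 ^ k / μ' ^ (2 * k)⌉₊ with hN₂_def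
  set N₃ : ℕ := ⌈2 * D / (B * ε)⌉₊ with hN₃_def
  refine ⟨max N₁ (max N₂ N₃), fun L _ hL Φ ν E δ hΦ1 hHΦ hEδ hN hlro => ?_⟩
  -- `N = L² ≥ L ≥ thresholds`
  have hLN : (L : ℝ) ≤ (L : ℝ) ^ 2 := by exact_mod_cast Nat.le_self_pow two_ne_zero L
  have hN0 : (0 : ℝ) < (L : ℝ) ^ 2 := by
    have : (0 : ℝ) < L := by exact_mod_cast Nat.pos_of_ne_zero (NeZero.ne L)
    positivity
  have hLr : ((max N₁ (max N₂ N₃) : ℕ) : ℝ) ≤ L := by exact_mod_cast hL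
  have hNle1 : N₁ ≤ Fintype.card (TorusSite 2 L) := by
    rw [card_torusSite_sq']
    exact (le_trans (le_max_left _ _) hL).trans (Nat.le_self_pow two_ne_zero L)
  have hNle2 : (N₂ : ℝ) ≤ (L : ℝ) ^ 2 :=
    le_trans (le_trans (by exact_mod_cast le_trans (le_max_left _ _) (le_max_right _ _)) hLr) hLN
  have hNle3 : (N₃ : ℝ) ≤ (L : ℝ) ^ 2 :=
    le_trans (le_trans (by exact_mod_cast le_trans (le_max_right _ _) (le_max_right _ _)) hLr) hLN
  set sys := dWaveKTSystem L 1 U μ dWaveFormFactor pairNormConst_dWave_pos with hsys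
  -- hypothesis iv)
  have hlro' : (μ' * (2 * pairNormConst dWaveFormFactor) * (L : ℝ) ^ 2) ^ 2 ≤
      (star Φ ⬝ᵥ ((pairField dWaveFormFactor L + (pairField dWaveFormFactor L)ᴴ) *ᵥ
        ((pairField dWaveFormFactor L + (pairField dWaveFormFactor L)ᴴ) *ᵥ Φ))).re := by
    rw [← hKdef, hsμ]; exact hlro
  have hΦ' := dWaveKTSystem_isLROEigenstate (L := L) 1 U μ dWaveFormFactor pairNormConst_dWave_pos
    hΦ1 hHΦ hN hμ' hμ'1 hlro'
  -- the size condition (`r′ = 25`, `N = L²`)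
  have hsize : (k : ℝ) ^ 2 * sys.r' * 2 ^ k ≤ μ' ^ (2 * k) * Fintype.card (TorusSite 2 L) := by
    rw [hsys, dWaveKTSystem_r', card_torusSite_sq', Nat.cast_pow]
    have hμk : 0 < μ' ^ (2 * k) := pow_pos hμ' _
    have h1 : (k : ℝ) ^ 2 * 25 * 2 ^ k / μ' ^ (2 * k) ≤ (L : ℝ) ^ 2 := (Nat.le_ceil _).trans hNle2
    rw [div_le_iff₀ hμk] at h1
    push_cast
    linarith
  -- the energy form (7.4)+(7.24) for the field `B`
  obtain ⟨hΞ1, hEΞ⟩ := sys.field_energy_le_of_card_ge hΦ' hk1 hsize B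
  -- variational principle for `E_L(B)`
  have hKh : (hubbardTorusWith 2 L 1 U μ).IsHermitian := isHermitian_hubbardTorusWith L 1 U μ
  have hOh : (pairField dWaveFormFactor L + (pairField dWaveFormFactor L)ᴴ).IsHermitian :=
    isHermitian_pairField_add_conjTranspose L
  have hKB : (hubbardTorusWith 2 L 1 U μ -
      (B : ℂ) • (pairField dWaveFormFactor L + (pairField dWaveFormFactor L)ᴴ)).IsHermitian := by
    rw [← dWaveSourceTorus_eq_sub]
    exact dWaveSourceTorus_isHermitian L (isHermitian_hubbardTorusWith L 1 U μ) B
  have hvar := groundEnergy_le_re_inner_toEuclideanCLM hKB (sys.xiState k (toLp 2 Φ)) hΞ1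
  rw [← dWaveKTSystem_field (L := L) 1 U μ dWaveFormFactor pairNormConst_dWave_pos B, ← hsys] at hvar
  -- the concavity sandwich `E_L(0) - E_L(B) ≤ B · Re ω_B(Δ+Δ†)`
  have hsw := sub_groundEnergy_le_sub_mul_re_groundStateFunctional hKh hOh B 0
  rw [Complex.ofReal_zero, zero_smul, sub_zero, sub_zero] at hsw
  -- `Re ω_B(Δ+Δ†) = 2 L² m_L(B)` (the tree lemma, up to the `DecidableEq` instance inside `ω`)
  have hω : ((hubbardTorusWith 2 L 1 U μ -
      (B : ℂ) • (pairField dWaveFormFactor L + (pairField dWaveFormFactor L)ᴴ)).groundStateFunctional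
        (pairField dWaveFormFactor L + (pairField dWaveFormFactor L)ᴴ)).re =
      2 * (L : ℝ) ^ 2 * dWaveSourceDensity L U μ B := by
    have h := re_groundStateFunctional_dWaveSource_op L U μ B
    rw [dWaveSourceTorus_eq_sub] at h
    convert h
  rw [hω] at hsw
  -- the trial-state half: `x ≥ (√2 s - ε/2) L²`
  have hx := hN₁ sys (toLp 2 Φ) E hΦ' rfl le_rfl hNle1
  rw [card_torusSite_sq', Nat.cast_pow, le_div_iff₀ hN0] at hx
  -- `D_sys = D ≤ (Bε/2) L²`
  have hDsys : (k : ℝ) * 2 ^ (k + 1) * sys.hbar * sys.r / μ' ^ k = D := by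
    rw [hsys, dWaveKTSystem_hbar, dWaveKTSystem_r, hD_def, hh₀def]
    norm_num
  rw [hDsys] at hEΞ
  have hDN : D ≤ B * ε / 2 * (L : ℝ) ^ 2 := by
    have h1 : 2 * D / (B * ε) ≤ (L : ℝ) ^ 2 := (Nat.le_ceil _).trans hNle3
    rw [div_le_iff₀ (mul_pos hB hε)] at h1
    linarith
  -- assemble
  have e : Real.sqrt 2 * μ' * (2 * K) = Real.sqrt 2 * s := by rw [mul_assoc, hsμ]
  rw [e] at hx
  -- (linear bookkeeping only: the one product needed is `B · hx`)
  have hBx := mul_le_mul_of_nonneg_left hx hB.le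
  have hL0 : (L : ℝ) ≠ 0 := by exact_mod_cast NeZero.ne L
  have key : B * ((Real.sqrt 2 * s - ε - δ / (B * (L : ℝ) ^ 2)) * (L : ℝ) ^ 2) ≤
      B * ((2 * dWaveSourceDensity L U μ B) * (L : ℝ) ^ 2) := by
    have e1 : B * ((Real.sqrt 2 * s - ε - δ / (B * (L : ℝ) ^ 2)) * (L : ℝ) ^ 2) =
        B * ((Real.sqrt 2 * s - ε) * (L : ℝ) ^ 2) - δ := by
      field_simp
    rw [e1]
    linarith [hvar, hEΞ, hsw, hBx, hDN]
  exact le_of_mul_le_mul_right (le_of_mul_le_mul_left key hB) hN0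


/-- **The Koma–Tasaki order parameter from LOW-LYING long-range-ordered states**: if eventually in `L`
the torus `(ℤ/(L+1)ℤ)²` carries a normalised particle-number eigenvector `Φ_L` which is an eigenvector of
`H(1,U) - μN` with energy `E_L ≤ E₀ + δ_L`, `δ_L/(L+1)² → 0`, and `(s(L+1)²)² ≤ Re Φ_L†(Δ_d+Δ_d†)²Φ_L`, then
`dWaveOrderParameter U μ ≥ √2 s/2` (KT94's "low-lying states", Def. 2.1, instead of ground states; covers
sector ground states canonically supported by `μ` up to `o(L²)`).
[cite: KomaTasaki1993, Theorem 7.3 (7.11)] [cite: KomaTasaki1994, Definition 2.1, §1 (0.2), Theorem 2.5] -/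
theorem le_dWaveOrderParameter_of_pairLRO_lowLying (s : ℝ) (hs : 0 < s)
    (hsK : s ≤ 2 * pairNormConst dWaveFormFactor) (δ : ℕ → ℝ)
    (hδ : Tendsto (fun L => δ L / ((L + 1 : ℕ) : ℝ) ^ 2) atTop (𝓝 0))
    (hLRO : ∀ᶠ L : ℕ in atTop, ∃ (Φ : FockIdx (L + 1) → ℂ) (ν : ℂ) (E : ℝ), star Φ ⬝ᵥ Φ = 1 ∧
      hubbardTorusWith 2 (L + 1) 1 U μ *ᵥ Φ = (E : ℂ) • Φ ∧
      E ≤ (hubbardTorusWith 2 (L + 1) 1 U μ).groundEnergy + δ L ∧ totalNumber *ᵥ Φ = ν • Φ ∧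
      (s * ((L + 1 : ℕ) : ℝ) ^ 2) ^ 2 ≤
        (star Φ ⬝ᵥ ((pairField dWaveFormFactor (L + 1) + (pairField dWaveFormFactor (L + 1))ᴴ) *ᵥ
          ((pairField dWaveFormFactor (L + 1) + (pairField dWaveFormFactor (L + 1))ᴴ) *ᵥ Φ))).re) :
    Real.sqrt 2 * s / 2 ≤ dWaveOrderParameter U μ := by
  rw [le_dWaveOrderParameter_iff_forall]
  intro h hh
  refine le_of_forall_sub_le fun ε hε => ?_
  obtain ⟨L₀, hL₀⟩ :=
    two_mul_dWaveSourceDensity_ge_of_pairLRO_lowLying U μ s h ε hs hsK hh hε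
  -- `δ_L/((L+1)² h) ≤ ε` eventually
  have hδε : ∀ᶠ L : ℕ in atTop, δ L / (h * ((L + 1 : ℕ) : ℝ) ^ 2) ≤ ε := by
    filter_upwards [hδ.eventually (Iic_mem_nhds (show (0 : ℝ) < h * ε by positivity))] with L hL
    have hL' : δ L / ((L + 1 : ℕ) : ℝ) ^ 2 ≤ h * ε := hL
    have hN1 : (0 : ℝ) < ((L + 1 : ℕ) : ℝ) ^ 2 := by positivity
    rw [div_le_iff₀ hN1] at hL'
    rw [div_le_iff₀ (by positivity)]
    linarith
  refine le_liminf_of_le (isCoboundedUnder_ge_of_eventually_le _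
    (x := 2 * ∑ e ∈ insert (0 : Site 2) unitSteps, |dWaveFormFactor e / Real.sqrt 2|) ?_) ?_
  · exact Eventually.of_forall fun L => dWaveSourceDensity_le_const (L + 1) U μ h
  · filter_upwards [hLRO, eventually_ge_atTop L₀, hδε] with L hL hLge hδL
    obtain ⟨Φ, ν, E, hΦ1, hHΦ, hE, hN, hlro⟩ := hL
    have h2 := hL₀ (L + 1) (Nat.le_succ_of_le hLge) Φ ν E (δ L) hΦ1 hHΦ hE hN hlro
    linarith

end LowLying

end Literature.MathematicalPhysics.QuantumLattice
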